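import Summits.QuantumAdvantage.QuantumAdvantage.Theorems.LinnikCubicClassGroupsDegreeOnePrimesEscapeDivisionPNTBounds
import Literature.NumberTheory.LFunctions.UniformClassGroupPNTTransferMain
import Literature.NumberTheory.LFunctions.UniformClassGroupPNTTransfer
import Mathlib.NumberTheory.Chebyshev
import HarnessLib

/-!
# Lemmas for the `π`-form of the division prime number theorem: Abel summation and the `√x` terms

Topic `Summits/QuantumAdvantage/QuantumAdvantage/Theorems`, cell B2b-1 (linnik-cubic), PART A (gen 10);
helper toward the crux `DegreeOnePrimesEscape` (stmt-QuantumAdvantage-11543) of route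
`LinnikCubicClassGroups`.  HONEST FRAMING: the value of this file is a THEOREM (kernel-checked bookkeeping)
— NOT summit progress.

* `card_filter_primesLE_eq_div_log_add_integral` — Abel summation for a predicate-restricted prime count:
  `#{p ≤ x : P p} = (Σ_{p ≤ x, P p} log p)/log x + ∫₂ˣ (Σ_{p ≤ t, P p} log p) dt/(t log² t)` (after Mathlib's
  `Chebyshev.primeCounting_eq_theta_div_log_add_integral`), with monotonicity / Chebyshev bound /
  integrability of the weighted sum;
* `pi_thresholds` — for `x ≥ d^L`: `256 ≤ x`, `d^{L'} ≤ x`, `16 ≤ log x`, `K d^{2e} log x ≤ 4 √x`;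
* `division_pi_transfer` — the tree's relative-error partial summation `abs_sub_exceptionalLiMain_le` with
  `h = δ⁻¹`, `E ≡ 1`, and the `√x` terms absorbed via `Li(x) − θ₁ Li(x^β) ≥ (x − θ₁ x^β/β)/(6 log x)`
  (`exists_exceptionalMainTerm_le`).
-/

noncomputable section

open scoped NumberField nonZeroDivisors
open Finset Real Ideal NumberField MeasureTheory Set
open Literature.NumberTheory.NumberFields Literature.NumberTheory.LFunctions
  Literature.NumberTheory.LFunctions.NumberField Literature.NumberTheory.LFunctions.AbelianDensity

namespace Summit.QuantumAdvantage.QuantumAdvantage.Theorems.DegreeOnePrimesEscape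

/-! ### Predicate-restricted prime sums: Abel summation -/

section Abel

variable (P : ℕ → Prop) [DecidablePred P]

/-- `t ↦ Σ_{p ≤ t, P p} log p` is monotone. -/
theorem sum_filter_primesLE_log_mono :
    Monotone fun t : ℝ => ∑ p ∈ (Nat.primesLE ⌊t⌋₊).filter P, Real.log p := by
  intro s t hst
  exact Finset.sum_le_sum_of_subset_of_nonneg
    (Finset.filter_subset_filter P (Nat.primesLE_mono (Nat.floor_le_floor hst)))
    fun p _ _ => Real.log_natCast_nonneg p

/-- `0 ≤ Σ_{p ≤ t, P p} log p ≤ θ(t) ≤ (log 4) t` for `t ≥ 0`. -/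
theorem sum_filter_primesLE_log_le {t : ℝ} (ht : 0 ≤ t) :
    0 ≤ ∑ p ∈ (Nat.primesLE ⌊t⌋₊).filter P, Real.log p ∧
      ∑ p ∈ (Nat.primesLE ⌊t⌋₊).filter P, Real.log p ≤ Real.log 4 * t := by
  refine ⟨Finset.sum_nonneg fun p _ => Real.log_natCast_nonneg p, ?_⟩
  calc ∑ p ∈ (Nat.primesLE ⌊t⌋₊).filter P, Real.log p ≤ ∑ p ∈ Nat.primesLE ⌊t⌋₊, Real.log p :=
        Finset.sum_le_sum_of_subset_of_nonneg (Finset.filter_subset _ _) fun p _ _ => Real.log_natCast_nonneg p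
    _ = Chebyshev.theta t := (Chebyshev.theta_eq_sum_primesLE t).symm
    _ ≤ Real.log 4 * t := Chebyshev.theta_le_log4_mul_x ht

/-- `t ↦ (Σ_{p ≤ t, P p} log p)/(t log² t)` is interval integrable on `[2, x]` (a monotone step function
against a continuous weight). -/
theorem intervalIntegrable_sum_filter_primesLE_log_div {x : ℝ} (hx : 2 ≤ x) :
    IntervalIntegrable (fun t : ℝ => (∑ p ∈ (Nat.primesLE ⌊t⌋₊).filter P, Real.log p) / (t * Real.log t ^ 2))
      volume 2 x := by
  have hcont : ContinuousOn (fun t : ℝ => (t * Real.log t ^ 2)⁻¹) (Set.uIcc 2 x) := by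
    refine fun t ht => ContinuousAt.continuousWithinAt ?_
    rw [Set.uIcc_of_le hx] at ht
    have ht0 : t ≠ 0 := by linarith [ht.1]
    have : t * Real.log t ^ 2 ≠ 0 :=
      mul_ne_zero ht0 (pow_ne_zero 2 (Real.log_pos (by linarith [ht.1])).ne')
    fun_prop (disch := assumption)
  have h := ((sum_filter_primesLE_log_mono P).intervalIntegrable (μ := volume) (a := 2) (b := x)).mul_continuousOn
    hcont
  have heq : (fun t : ℝ => (∑ p ∈ (Nat.primesLE ⌊t⌋₊).filter P, Real.log p) / (t * Real.log t ^ 2)) =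
      fun t : ℝ => (∑ p ∈ (Nat.primesLE ⌊t⌋₊).filter P, Real.log p) * (t * Real.log t ^ 2)⁻¹ := by
    funext t; rw [div_eq_mul_inv]
  rw [heq]; exact h

/-- **Abel summation for a predicate-restricted prime count**: for `x ≥ 2`,
`#{p ≤ x : P p} = (Σ_{p ≤ x, P p} log p)/log x + ∫₂ˣ (Σ_{p ≤ t, P p} log p) dt/(t log² t)`
(as Mathlib's `Chebyshev.primeCounting_eq_theta_div_log_add_integral`, with the predicate inserted). -/
theorem card_filter_primesLE_eq_div_log_add_integral {x : ℝ} (hx : 2 ≤ x) :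
    ((((Nat.primesLE ⌊x⌋₊).filter P).card : ℕ) : ℝ) =
      (∑ p ∈ (Nat.primesLE ⌊x⌋₊).filter P, Real.log p) / Real.log x +
        ∫ t in (2 : ℝ)..x, (∑ p ∈ (Nat.primesLE ⌊t⌋₊).filter P, Real.log p) / (t * Real.log t ^ 2) := by
  classical
  set a : ℕ → ℝ := fun k => if k.Prime ∧ P k then Real.log k else 0 with ha
  have ha0 : a 0 = 0 := by simp [ha, Nat.not_prime_zero]
  have ha1 : a 1 = 0 := by simp [ha, Nat.not_prime_one]
  -- the weighted theta as a sum over `Icc 0 ⌊t⌋`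
  have hS : ∀ t : ℝ, ∑ k ∈ Icc 0 ⌊t⌋₊, a k = ∑ p ∈ (Nat.primesLE ⌊t⌋₊).filter P, Real.log p := by
    intro t
    rw [Nat.primesLE_eq_filter_Icc_zero, Finset.filter_filter, Finset.sum_filter]
  -- the count as `Σ (log k)⁻¹ a k`
  have hcount : ((((Nat.primesLE ⌊x⌋₊).filter P).card : ℕ) : ℝ) =
      ∑ k ∈ Icc 0 ⌊x⌋₊, (fun t : ℝ => (Real.log t)⁻¹) k * a k := by
    rw [Nat.primesLE_eq_filter_Icc_zero, Finset.filter_filter, Finset.card_eq_sum_ones, Nat.cast_sum,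
      Finset.sum_filter]
    refine Finset.sum_congr rfl fun k _ => ?_
    simp only [ha]
    split_ifs with h
    · have hlog : Real.log k ≠ 0 :=
        Real.log_ne_zero_of_pos_of_ne_one (by exact_mod_cast h.1.pos) (by exact_mod_cast h.1.ne_one)
      rw [Nat.cast_one, inv_mul_cancel₀ hlog]
    · simp
  rw [hcount, sum_mul_eq_sub_integral_mul₁ a (f := fun t : ℝ => (Real.log t)⁻¹) ha0 ha1 x ?hdiff ?hint,
    ← intervalIntegral.integral_of_le hx]
  case hdiff =>
    intro z ⟨hz1, _⟩
    have : z ≠ 0 := by linarith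
    have : Real.log z ≠ 0 := by apply Real.log_ne_zero_of_pos_of_ne_one <;> linarith
    fun_prop
  case hint =>
    refine ContinuousOn.integrableOn_Icc fun z ⟨hz1, _⟩ => ContinuousWithinAt.congr ?_
      (fun _ _ => Real.deriv_inv_log_apply) Real.deriv_inv_log_apply
    have : z ≠ 0 := by linarith
    have : Real.log z ^ 2 ≠ 0 := by
      refine pow_ne_zero 2 <| Real.log_ne_zero_of_pos_of_ne_one ?_ ?_ <;> linarith
    exact ContinuousAt.continuousWithinAt <| by fun_prop
  simp only [hS, Real.deriv_inv_log]
  have hI : ∫ t in (2 : ℝ)..x, -t⁻¹ / Real.log t ^ 2 * ∑ p ∈ (Nat.primesLE ⌊t⌋₊).filter P, Real.log p =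
      -∫ t in (2 : ℝ)..x, (∑ p ∈ (Nat.primesLE ⌊t⌋₊).filter P, Real.log p) / (t * Real.log t ^ 2) := by
    rw [← intervalIntegral.integral_neg]
    exact intervalIntegral.integral_congr fun t _ => by ring
  rw [hI]
  ring

end Abel

/-! ### The `π`-form -/

/-- The `√x`-absorption threshold: for `x ≥ d^L`, `256 ≤ x`, `d^{L'} ≤ x`, `16 ≤ log x` and
`K · d^{2e} · log x ≤ 4 √x`. -/
theorem pi_thresholds {K : ℝ} (L' e : ℝ) (hK : 1 ≤ K) :
    ∃ L : ℝ, 0 < L ∧ ∀ d : ℝ, 3 ≤ d → ∀ x : ℝ, d ^ L ≤ x →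
      256 ≤ x ∧ d ^ L' ≤ x ∧ 16 ≤ Real.log x ∧ K * d ^ (2 * e) * Real.log x ≤ 4 * Real.sqrt x := by
  set L : ℝ := max (max L' 16) (8 * e + Real.logb 3 (K ^ 4)) with hL
  refine ⟨L, lt_of_lt_of_le (by norm_num) ((le_max_right _ _).trans (le_max_left _ _)), fun d hd3 x hx => ?_⟩
  have hd0 : (0 : ℝ) < d := by linarith
  have hd1 : (1 : ℝ) ≤ d := by linarith
  have hlog3 : 1 ≤ Real.log d := by
    rw [Real.le_log_iff_exp_le hd0]; have := Real.exp_one_lt_d9; linarith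
  have h16L : (16 : ℝ) ≤ L := (le_max_right _ _).trans (le_max_left _ _)
  have hx16' : d ^ (16 : ℝ) ≤ x := (Real.rpow_le_rpow_of_exponent_le hd1 h16L).trans hx
  have hx16 : 16 ≤ Real.log x := by
    have h1 := Real.log_le_log (Real.rpow_pos_of_pos hd0 _) hx16'
    rw [Real.log_rpow hd0] at h1; nlinarith
  have hx256 : (256 : ℝ) ≤ x := by
    have h3 : (3 : ℝ) ^ (16 : ℝ) ≤ d ^ (16 : ℝ) := Real.rpow_le_rpow (by norm_num) hd3 (by norm_num)
    have : (256 : ℝ) ≤ (3 : ℝ) ^ (16 : ℝ) := by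
      rw [show (16 : ℝ) = ((16 : ℕ) : ℝ) by norm_num, Real.rpow_natCast]; norm_num
    linarith
  have hx0 : 0 < x := by linarith
  have hxL' : d ^ L' ≤ x := (Real.rpow_le_rpow_of_exponent_le hd1 ((le_max_left _ _).trans (le_max_left _ _))).trans hx
  refine ⟨hx256, hxL', hx16, ?_⟩
  -- `K⁴ d^{8e} ≤ x`, so `K d^{2e} ≤ x^{1/4}` and `K d^{2e} log x ≤ 4 K d^{2e} x^{1/4} ≤ 4 √x`
  have hK4 : 1 ≤ K ^ 4 := one_le_pow₀ hK
  have hB : K ^ 4 * d ^ (8 * e) ≤ x := (mul_rpow_le_rpow_of_logb hd3 hK4 (le_max_right _ _)).trans hx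
  set D : ℝ := d ^ (2 * e) with hD
  have hD0 : 0 < D := Real.rpow_pos_of_pos hd0 _
  have hKD : 0 ≤ K * D := by positivity
  have hKD4 : (K * D) ^ 4 ≤ x := by
    have : (K * D) ^ 4 = K ^ 4 * d ^ (8 * e) := by
      rw [mul_pow, hD, ← Real.rpow_natCast (d ^ (2 * e)), ← Real.rpow_mul hd0.le]; ring_nf
    rw [this]; exact hB
  have hq : K * D ≤ x ^ (1 / 4 : ℝ) := by
    have h1 : ((K * D) ^ 4) ^ (1 / 4 : ℝ) ≤ x ^ (1 / 4 : ℝ) :=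
      Real.rpow_le_rpow (by positivity) hKD4 (by norm_num)
    have h2 : ((K * D) ^ 4) ^ (1 / 4 : ℝ) = K * D := by
      rw [← Real.rpow_natCast (K * D) 4, ← Real.rpow_mul hKD]; norm_num
    rw [h2] at h1; exact h1
  have hlogx : Real.log x ≤ 4 * x ^ (1 / 4 : ℝ) := by
    have := Real.log_le_rpow_div hx0.le (by norm_num : (0 : ℝ) < 1 / 4)
    linarith [show x ^ (1 / 4 : ℝ) / (1 / 4) = 4 * x ^ (1 / 4 : ℝ) by ring]
  have hsqrt : Real.sqrt x = x ^ (1 / 4 : ℝ) * x ^ (1 / 4 : ℝ) := by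
    rw [Real.sqrt_eq_rpow, ← Real.rpow_add hx0]; norm_num
  have hq0 : 0 ≤ x ^ (1 / 4 : ℝ) := Real.rpow_nonneg hx0.le _
  calc K * d ^ (2 * e) * Real.log x ≤ K * D * (4 * x ^ (1 / 4 : ℝ)) :=
        mul_le_mul_of_nonneg_left hlogx hKD
    _ ≤ x ^ (1 / 4 : ℝ) * (4 * x ^ (1 / 4 : ℝ)) := mul_le_mul_of_nonneg_right hq (by positivity)
    _ = 4 * Real.sqrt x := by rw [hsqrt]; ring

/-- The transfer from the `θ`-form to the `π`-form for one sign `θ₁ ∈ [−1, 1]` and exponent `β`. -/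
theorem division_pi_transfer {T : ℝ → ℝ} {P δ θ₁ β ε₀ ε y x F W : ℝ} (hδ : 0 < δ) (hδ1 : δ ≤ 1)
    (hθ : |θ₁| ≤ 1) (hβ : 1 / 2 < β) (hβ1 : β ≤ 1) (hε₀ : 0 ≤ ε₀) (hεε : 60 * ε₀ ≤ ε) (hy : 2 ≤ y)
    (hT0 : ∀ t, 2 ≤ t → 0 ≤ T t) (hTB : ∀ t, 2 ≤ t → T t ≤ Real.log 4 * t)
    (hTE : ∀ t, y ≤ t → |T t - δ * (t - θ₁ * t ^ β / β)| ≤ ε₀ * (δ * (t - θ₁ * t ^ β / β)))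
    (hx : 256 ≤ x) (hxy : y ^ 2 ≤ x)
    (hTint : IntervalIntegrable (fun t ↦ T t / (t * Real.log t ^ 2)) volume 2 x)
    (hP : P = T x / Real.log x + ∫ t in (2 : ℝ)..x, T t / (t * Real.log t ^ 2))
    (hF : F = x - θ₁ * x ^ β / β) (hWF : W ≤ F) (hjunk : 288 * Real.sqrt x * Real.log x ≤ ε * (δ * W)) :
    |P - δ * (offsetLogIntegral x - θ₁ * offsetLogIntegral (x ^ β))| ≤
      ε * (δ * (offsetLogIntegral x - θ₁ * offsetLogIntegral (x ^ β))) := by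
  have hx1 : (1 : ℝ) < x := by linarith
  have hx0 : (0 : ℝ) < x := by linarith
  have hlogx : 0 < Real.log x := Real.log_pos hx1
  set G : ℝ := offsetLogIntegral x - θ₁ * offsetLogIntegral (x ^ β) with hG
  -- the tree's relative-error partial summation, with `h = δ⁻¹`, `E ≡ 1`, `A = ε₀`, `B = log 4`
  have hmain := abs_sub_exceptionalLiMain_le (T := T) (E := fun _ => (1 : ℝ)) (P := P) (h := δ⁻¹)
    (θ₁ := θ₁) (β := β) (A := ε₀) (B := Real.log 4) (y := y) (x := x) (inv_pos.mpr hδ) hθ hβ hβ1 hε₀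
    (Real.log_nonneg (by norm_num)) hy hT0 hTB antitoneOn_const (fun _ _ => zero_le_one)
    (fun t ht => by
      rw [div_inv_eq_mul, mul_one, mul_comm (t - θ₁ * t ^ β / β) δ]; exact hTE t ht)
    hx hxy hTint hP
  rw [div_inv_eq_mul, div_inv_eq_mul, mul_one,
    mul_comm (offsetLogIntegral x - θ₁ * offsetLogIntegral (x ^ β)) δ, ← hG] at hmain
  -- `G ≥ F/(6 log x)` and the `√x` terms are absorbed
  obtain ⟨w, hw0, hwt, hwG⟩ := exists_exceptionalMainTerm_le hθ hβ hβ1 hx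
  have hFw : F ≤ w * x := by rw [hF]; exact hwt x ⟨hx1.le, le_rfl⟩
  have hGF : F ≤ 6 * Real.log x * G := by nlinarith
  have hlog4 : Real.log 4 < 1.3863 := by
    rw [show (4:ℝ) = 2 ^ 2 by norm_num, Real.log_pow]; have := Real.log_two_lt_d9; push_cast; linarith
  have hcoef : 3 * Real.log 4 + 19 * δ ≤ 24 := by nlinarith
  have hsx : 0 ≤ Real.sqrt x := Real.sqrt_nonneg x
  have hjunk' : (3 * Real.log 4 + 19 * δ) * Real.sqrt x ≤ ε / 2 * (δ * G) := by
    -- `24 √x · 6 log x · 2 = 288 √x log x ≤ ε δ W ≤ ε δ F ≤ ε δ · 6 log x · G`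
    have h1 : ε * (δ * W) ≤ ε * (δ * F) := by
      have hε0 : 0 ≤ ε := by linarith
      exact mul_le_mul_of_nonneg_left (mul_le_mul_of_nonneg_left hWF hδ.le) hε0
    have h2 : 288 * Real.sqrt x * Real.log x ≤ ε * (δ * (6 * Real.log x * G)) := by
      have hε0 : 0 ≤ ε := by linarith
      exact hjunk.trans (h1.trans (mul_le_mul_of_nonneg_left (mul_le_mul_of_nonneg_left hGF hδ.le) hε0))
    have h3 : (3 * Real.log 4 + 19 * δ) * Real.sqrt x * Real.log x ≤ ε / 2 * (δ * G) * Real.log x := by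
      nlinarith [mul_nonneg hsx hlogx.le]
    exact le_of_mul_le_mul_right h3 hlogx
  calc |P - δ * G| ≤ 30 * ε₀ * (δ * G) + (3 * Real.log 4 + 19 * δ) * Real.sqrt x := hmain
    _ ≤ ε / 2 * (δ * G) + ε / 2 * (δ * G) := by
        have hG0 : 0 ≤ δ * G := by
          have : 0 ≤ F := by
            rw [hF]; exact exceptionalMainTerm_nonneg hθ hβ hβ1 (by linarith)
          nlinarith
        nlinarith
    _ = ε * (δ * G) := by ring

end Summit.QuantumAdvantage.QuantumAdvantage.Theorems.DegreeOnePrimesEscape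

end
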